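import Summits.HodgeConjecture.HodgeConjecture.Theorems.UHeadGlueClassMap                          -- part 1 (this seat): class map, (U2+) relation, two-rep P6, L3 (over ★ P6 p723133, ★ L4 p723909, ★ L2 p722867)
import Literature.AlgebraicGeometry.Motives.AlgPointsLiftAlongOpenImmersion                          -- ★ L5 p723650 (this seat): the `AlgPoints` lift along an open immersion
import Summits.HodgeConjecture.HodgeConjecture.Theorems.SiegelUniversalFamilyHodgeFrames               -- ★ `smooth_baseChange_M`, `isQuasiProjectiveOver_baseChange_M`
import Summits.HodgeConjecture.CorCM.HypDel.M1primeOfFU                                             -- ★ `W1.smooth_qproj_of_F` ((F-c′) for every `𝓜`)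
import Literature.AlgebraicGeometry.HodgeTheory.SmoothQuasiProjectiveComponentsOfInvariant            -- ★ B5b `exists_cofan_of_isLocallyConstant_of_isConnected_fiber`
import Literature.AlgebraicGeometry.ModuliOfAbelianVarieties.SiegelShimuraSetPrincipalDissection       -- ★ R60-27 `exists_principalRep`
import Literature.Geometry.Kaehler.SiegelTorusEvenThetaConstants                                      -- ★ `isPreconnected_siegelUpperHalfSpace`
import HarnessLib

/-!
# (U)-HEAD glue core, part 2 — THE ASSEMBLY `glue_core : (F) → U-a → U-e → (U)`

Cell `hodgecm-mathlib`, (U)-HEAD glue F-δ (census `typers/CENSUS-Uglue.B-p21g13.md` 41585aa5, B-plan2 road (R1), UHead v0.12–v0.15 §4e).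
Namespace `Summit.HodgeConjecture.CorCM.HypDel.UHead`.  KERNEL ONLY: one theorem; no definition, no named fact, no instance, no
`sorry`.  GIVEN ★ (F) `lan2013_siegelFineModuliScheme`, node U-a (`U_a_siegelAdmissibleTriple_exists`: admissible triples exist at
every `(Z, r)`) and node U-e (`U_e_siegelClassifyingMap_analytic`: the classifying map is continuous / open / holomorphic in affine
coordinates) imply the complex-analytic uniformisation ★ (U) `siegelModuli_complexUniformisation` of the Siegel fine moduli scheme
([MumfordFogartyKirwan1994] App. 7A pp. 234–235: «𝒜_{g,δ} × Spec ℂ ≅ ℌ_g/Γ_δ … the irreducibility follows from the analytic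
description» (fn. 20); [Milne2005ShimuraVarieties] §6 Thm. 6.11; [Deligne1971TravauxShimura] 4.11–4.12, 4.16).  Road B of the
census (G0–G7): principal representatives, the classifying points `f_c Z`, U-e, the class map `κ` and its fibres (part 1), the B5b
component cofan of `𝓜 ⊗ ℂ` (irreducible pieces — this is where (F)'s `Smooth` + `IsQuasiProjectiveOver` enter), the lifts
`unif_c := (map ι_c)⁻¹ ∘ f_c` (★ L5), and the (U3) junction by the two-representative P6.  This is `UHead.stub_Uglue` CLOSED:
`stub_Uglue := glue_core`.  HC_CM is proved only modulo the 7 printed citations until rung 0 closes.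
-/

set_option autoImplicit false

noncomputable section

open CategoryTheory CategoryTheory.Limits AlgebraicGeometry Matrix Topology
open scoped Matrix.Norms.Elementwise
open Literature.AlgebraicGeometry.Motives (SchemeOver ComplexPoints AlgPoints specOver AbelianVariety CartierDivisor)
open Literature.AlgebraicGeometry.AbelianSchemes (PolarizedAbelianSchemeWithLevel AbelianSchemeOver)
open Literature.NumberTheory.Automorphic (siegelUpperHalfSpace)
open Literature.AlgebraicGeometry.ModuliOfAbelianVarieties

namespace Summit.HodgeConjecture.CorCM.HypDel.UHead

open Literature.AlgebraicGeometry
open Summit.HodgeConjecture.HodgeConjecture.Theorems.UnivFamilyHodgeFrames (smooth_baseChange_M isQuasiProjectiveOver_baseChange_M)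
open Literature.AlgebraicGeometry.HodgeTheory (IsQuasiProjectiveOver exists_cofan_of_isLocallyConstant_of_isConnected_fiber)

/-- **THE GLUE CORE (road B; census `CENSUS-Uglue.B-p21g13` G0–G7, UHead v0.12 §4e): GIVEN ★ (F), node U-a and node U-e imply
the complex-analytic uniformisation (U) of the Siegel fine moduli scheme** — P6 = U-c (ii) (★ p723133, A-p06 (g12)) and L4 = pull-back uniqueness for triples (★, B-p16 (g11)) consumed by import
through part 1 `UHeadGlueClassMap`; the only hypotheses left are the stub's own binders (F), U-a, U-e.  G0 principal representatives
`r_c` (★ `exists_principalRep`); G1 `f_c Z :=` the `ℂ`-side classifying point of U-a's triple at `(Z, r_c)`; G2 U-e ⇒ `f_c`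
continuous / open / holomorphic; G3 class map `κ(x) :=` the residue of the fibre triple `𝓜.univ ×_𝓜 x` (★ L4
`exists_isAdmissibleAt`), with `κ⁻¹{c} = f_c(𝔥_g)` (P6 two-rep form + ★ L2, and L4 + ★ (α-inv) + ★ `units_zmod_eq_of_isAdmissibleAt`);
G4 `κ` locally constant with connected fibres ⇒ ★ B5b cofan `S_c ↪ 𝓜 ⊗ ℂ` of IRREDUCIBLE open-closed pieces (this is where
(F)'s `Smooth` + `IsQuasiProjectiveOver` enter) ⇒ (U1); G5 `unif_c := (map ι_c)⁻¹ ∘ f_c` ⇒ (U2+) by the L5 transfer lemmas,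
the iff-clause by `classifyingMap_eq_iff_rel`; G6 (U3∃) and G7 (U3-D3) by the two-rep P6 + ★ `exists_isBaseChangeVia_classifyingMap`.
[cite: MumfordFogartyKirwan1994, Appendix to Ch. 7 §A (pp. 234–235, fn. 20)] [cite: Milne2005ShimuraVarieties, §6 Thm. 6.11 p. 74, Lemma 5.13 p. 57]
[cite: Deligne1971TravauxShimura, 4.11–4.12 pp. 148–149, Exemple 4.16 p. 150] -/
theorem glue_core (hF : lan2013_siegelFineModuliScheme)
    (hUa :
  ∀ (g N : ℕ) (δ : Fin g → ℕ) (_hg : 0 < g) (hδ : IsPolarizationType δ) (_hN : 3 ≤ N)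
    (c : (ZMod N)ˣ) (u : finAdeleQˣ) (r : gspFinAdelic δ),
    -- `r = diag(1, u·1)` is a principal representative of the component index `c` (the four `r`-binders of ★ (U) (U3), verbatim)
    (∀ v, Valued.v ((u : finAdeleQ) v) = 1) →
    (u : finAdeleQ) - ((c : ZMod N).val : ℕ) ∈ levelIdeal N →
    r ∈ principalLevelSubgroup δ 1 →
    IsMultiplier (typeFormOver δ finAdeleQ) (r : GL (Fin g ⊕ Fin g) finAdeleQ) u →
    ((r : GL (Fin g ⊕ Fin g) finAdeleQ) : Matrix (Fin g ⊕ Fin g) (Fin g ⊕ Fin g) finAdeleQ) =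
      Matrix.fromBlocks 1 0 0 ((u : finAdeleQ) • (1 : Matrix (Fin g) (Fin g) finAdeleQ)) →
    ∀ (Z : Matrix (Fin g) (Fin g) ℂ) (hZ : Z ∈ siegelUpperHalfSpace g),
      ∃ P' : PolarizedAbelianSchemeWithLevel g N δ (specOver ℚ ℂ).left, IsAdmissibleAt hδ r Z hZ P')
    (hUe :
  ∀ (g N : ℕ) (δ : Fin g → ℕ) (_hg : 0 < g) (hδ : IsPolarizationType δ) (_hN : 3 ≤ N)
    (𝓜 : SiegelFineModuliScheme g N δ) (c : (ZMod N)ˣ) (u : finAdeleQˣ) (r : gspFinAdelic δ)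
    (f : Matrix (Fin g) (Fin g) ℂ → ComplexPoints ((Motives.baseChange ℚ ℂ).obj 𝓜.M)),
    haveI : IsLocallyNoetherian (specOver ℚ ℂ).left :=
      inferInstanceAs (IsLocallyNoetherian (Spec (CommRingCat.of ℂ)))
    -- `r = diag(1, u·1)` is a principal representative of the component index `c` (the four `r`-binders of ★ (U) (U3), verbatim)
    (∀ v, Valued.v ((u : finAdeleQ) v) = 1) →
    (u : finAdeleQ) - ((c : ZMod N).val : ℕ) ∈ levelIdeal N →
    r ∈ principalLevelSubgroup δ 1 →
    IsMultiplier (typeFormOver δ finAdeleQ) (r : GL (Fin g ⊕ Fin g) finAdeleQ) u →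
    ((r : GL (Fin g ⊕ Fin g) finAdeleQ) : Matrix (Fin g ⊕ Fin g) (Fin g ⊕ Fin g) finAdeleQ) =
      Matrix.fromBlocks 1 0 0 ((u : finAdeleQ) • (1 : Matrix (Fin g) (Fin g) finAdeleQ)) →
    -- U-a as a hypothesis: an admissible triple exists at every point
    (∀ (Z : Matrix (Fin g) (Fin g) ℂ) (hZ : Z ∈ siegelUpperHalfSpace g),
        ∃ P' : PolarizedAbelianSchemeWithLevel g N δ (specOver ℚ ℂ).left, IsAdmissibleAt hδ r Z hZ P') →
    -- `f` IS the classifying map on `𝔥_g`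
    (∀ (Z : Matrix (Fin g) (Fin g) ℂ) (hZ : Z ∈ siegelUpperHalfSpace g)
        (P' : PolarizedAbelianSchemeWithLevel g N δ (specOver ℚ ℂ).left), IsAdmissibleAt hδ r Z hZ P' →
        f Z = AlgPoints.baseChangeEquiv (algebraMap ℚ ℂ) 𝓜.M (𝓜.classifyingMap (specOver ℚ ℂ) P')) →
    -- the three analytic clauses (★ `SiegelModuliDatum` :489 / :491 / :502 spelling)
      ContinuousOn f (siegelUpperHalfSpace g) ∧
      IsOpenMap ((siegelUpperHalfSpace g).restrict f) ∧
      ∀ (U : ((Motives.baseChange ℚ ℂ).obj 𝓜.M).left.affineOpens)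
        (s : ((Motives.baseChange ℚ ℂ).obj 𝓜.M).left.presheaf.obj (Opposite.op (↑U : ((Motives.baseChange ℚ ℂ).obj 𝓜.M).left.Opens))),
        DifferentiableOn ℂ (fun Z ↦ AlgPoints.evalOrZero (↑U : ((Motives.baseChange ℚ ℂ).obj 𝓜.M).left.Opens) s (f Z))
          (siegelUpperHalfSpace g ∩ f ⁻¹' {P | P.pt ∈ (↑U : ((Motives.baseChange ℚ ℂ).obj 𝓜.M).left.Opens)})) :
    siegelModuli_complexUniformisation := by
  intro g N δ hg hδ hN 𝓜
  haveI hLN : IsLocallyNoetherian (specOver ℚ ℂ).left := inferInstanceAs (IsLocallyNoetherian (Spec (CommRingCat.of ℂ)))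
  classical
  have hN0 : N ≠ 0 := by omega
  haveI : NeZero N := ⟨hN0⟩
  -- (F): the carrier `𝓜 ⊗ ℂ` is smooth and quasi-projective
  obtain ⟨hMs, hMq, -⟩ := W1.smooth_qproj_of_F hF hg hδ hN 𝓜
  haveI : Smooth ((Motives.baseChange ℚ ℂ).obj 𝓜.M).hom := smooth_baseChange_M 𝓜 hMs
  have hXq : IsQuasiProjectiveOver ((Motives.baseChange ℚ ℂ).obj 𝓜.M) := isQuasiProjectiveOver_baseChange_M 𝓜 hMq
  -- G0: principal representatives `r_c = diag(1, u_c·1)`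
  choose u r hu huc hr1 hru hrmat using fun c : (ZMod N)ˣ => exists_principalRep δ hN0 c
  -- G1: U-a's triples at `(Z, r_c)` and the `ℂ`-side classifying points `f_c Z`
  choose P₀ hP₀ using fun (c : (ZMod N)ˣ) (Z : Matrix (Fin g) (Fin g) ℂ) (hZ : Z ∈ siegelUpperHalfSpace g) =>
    hUa g N δ hg hδ hN c (u c) (r c) (hu c) (huc c) (hr1 c) (hru c) (hrmat c) Z hZ
  set bCE := AlgPoints.baseChangeEquiv (algebraMap ℚ ℂ) 𝓜.M with hbCE
  let f : (ZMod N)ˣ → Matrix (Fin g) (Fin g) ℂ → ComplexPoints ((Motives.baseChange ℚ ℂ).obj 𝓜.M) := fun c Z =>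
    if hZ : Z ∈ siegelUpperHalfSpace g then bCE (𝓜.classifyingMap (specOver ℚ ℂ) (P₀ c Z hZ))
    else bCE (𝓜.classifyingMap (specOver ℚ ℂ) (P₀ c _ (I_smul_one_mem_siegelUpperHalfSpace g)))
  have hf : ∀ c Z (hZ : Z ∈ siegelUpperHalfSpace g), f c Z = bCE (𝓜.classifyingMap (specOver ℚ ℂ) (P₀ c Z hZ)) :=
    fun c Z hZ => dif_pos hZ
  -- the classifying point of EVERY triple admissible at `(Z, r′)`, `r′` any principal representative of `c`, is `f_c Z`
  have hfP : ∀ (c : (ZMod N)ˣ) (u' : finAdeleQˣ) (r' : gspFinAdelic δ), (∀ v, Valued.v ((u' : finAdeleQ) v) = 1) →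
      (u' : finAdeleQ) - ((c : ZMod N).val : ℕ) ∈ levelIdeal N → r' ∈ principalLevelSubgroup δ 1 →
      ((r' : GL (Fin g ⊕ Fin g) finAdeleQ) : Matrix (Fin g ⊕ Fin g) (Fin g ⊕ Fin g) finAdeleQ) =
        Matrix.fromBlocks 1 0 0 ((u' : finAdeleQ) • (1 : Matrix (Fin g) (Fin g) finAdeleQ)) →
      ∀ (Z : Matrix (Fin g) (Fin g) ℂ) (hZ : Z ∈ siegelUpperHalfSpace g)
        (P' : PolarizedAbelianSchemeWithLevel g N δ (specOver ℚ ℂ).left), IsAdmissibleAt hδ r' Z hZ P' →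
        f c Z = bCE (𝓜.classifyingMap (specOver ℚ ℂ) P') := by
    intro c u' r' hu' hu'c hr'1 hr'mat Z hZ P' hP'
    rw [hf c Z hZ, classifyingMap_eq_of_isAdmissibleAt₂ hg hδ hN 𝓜
      (inv_mul_mem_principalLevelSubgroup_of_principalRep (hu c) (huc c) (hrmat c) hu' hu'c hr'mat) hr'1 hZ (hP₀ c Z hZ) hP']
  -- G2: U-e for `f_c`
  have hUe' : ∀ c : (ZMod N)ˣ, ContinuousOn (f c) (siegelUpperHalfSpace g) ∧
      IsOpenMap ((siegelUpperHalfSpace g).restrict (f c)) ∧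
      ∀ (U : ((Motives.baseChange ℚ ℂ).obj 𝓜.M).left.affineOpens)
        (s : ((Motives.baseChange ℚ ℂ).obj 𝓜.M).left.presheaf.obj (Opposite.op (↑U : ((Motives.baseChange ℚ ℂ).obj 𝓜.M).left.Opens))),
        DifferentiableOn ℂ (fun Z ↦ AlgPoints.evalOrZero (↑U : ((Motives.baseChange ℚ ℂ).obj 𝓜.M).left.Opens) s (f c Z))
          (siegelUpperHalfSpace g ∩ f c ⁻¹' {P | P.pt ∈ (↑U : ((Motives.baseChange ℚ ℂ).obj 𝓜.M).left.Opens)}) := fun c =>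
    hUe g N δ hg hδ hN 𝓜 c (u c) (r c) (f c) (hu c) (huc c) (hr1 c) (hru c) (hrmat c) (fun Z hZ => ⟨P₀ c Z hZ, hP₀ c Z hZ⟩)
      (fun Z hZ P' hP' => hfP c (u c) (r c) (hu c) (huc c) (hr1 c) (hrmat c) Z hZ P' hP')
  -- G3: the class map `κ` (residue of the fibre triple) and its fibres
  choose κ uκ rκ huκ hucκ hr1κ hruκ hrmatκ Zκ hZκ hadmκ using fun x : ComplexPoints ((Motives.baseChange ℚ ℂ).obj 𝓜.M) =>
    exists_residue_isAdmissibleAt hg hδ hN (𝓜.univ.baseChange (bCE.symm x).left)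
  have hfib : ∀ (c : (ZMod N)ˣ) (x : ComplexPoints ((Motives.baseChange ℚ ℂ).obj 𝓜.M)),
      κ x = c ↔ x ∈ f c '' siegelUpperHalfSpace g := by
    intro c x
    constructor
    · intro hc
      refine ⟨Zκ x, hZκ x, ?_⟩
      rw [hfP c (uκ x) (rκ x) (huκ x) (hc ▸ hucκ x) (hr1κ x) (hrmatκ x) (Zκ x) (hZκ x) _ (hadmκ x),
        classifyingMap_univ_baseChange, Equiv.apply_symm_apply]
    · rintro ⟨Z, hZ, rfl⟩
      have heq : 𝓜.classifyingMap (specOver ℚ ℂ) (P₀ c Z hZ) =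
          𝓜.classifyingMap (specOver ℚ ℂ) (𝓜.univ.baseChange (bCE.symm (f c Z)).left) := by
        rw [classifyingMap_univ_baseChange, hf c Z hZ, Equiv.symm_apply_apply]
      exact (residue_eq_of_classifyingMap_eq hg hδ hN 𝓜 (huc c) (hr1 c) (hru c) (huκ _) (hucκ _) (hr1κ _) (hruκ _)
        (hP₀ c Z hZ) (hadmκ _) heq).symm
  have hfibre : ∀ c : (ZMod N)ˣ, κ ⁻¹' {c} = f c '' siegelUpperHalfSpace g := fun c => Set.ext fun x => hfib c x
  -- G4: `κ` is locally constant with connected fibres ⇒ the component cofan (★ B5b; needs (F)'s smooth + quasi-projective)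
  have hκlc : IsLocallyConstant κ := by
    refine IsLocallyConstant.iff_isOpen_fiber.2 fun c => ?_
    rw [hfibre c, ← Set.range_restrict]
    exact (hUe' c).2.1.isOpen_range
  have hκconn : ∀ c, IsConnected (κ ⁻¹' {c}) := fun c => by
    rw [hfibre c]
    exact ⟨⟨f c _, Set.mem_image_of_mem _ (I_smul_one_mem_siegelUpperHalfSpace g)⟩,
      Literature.Geometry.Kaehler.ComplexTorus.isPreconnected_siegelUpperHalfSpace.image _ (hUe' c).1⟩
  obtain ⟨S, ι, hιo, -, hirr, -, -, hconnS, hrange, hcol⟩ :=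
    exists_cofan_of_isLocallyConstant_of_isConnected_fiber ((Motives.baseChange ℚ ℂ).obj 𝓜.M) hXq κ hκlc hκconn
  haveI hιo' : ∀ c, IsOpenImmersion (ι c).left := hιo
  haveI hne : ∀ c, Nonempty (ComplexPoints (S c)) := fun c => (hconnS c).toNonempty
  -- `f_c` takes values in `ι_c(S_c)(ℂ) = κ⁻¹{c}`, and exhausts it
  have hD : ∀ c, ∀ Z ∈ siegelUpperHalfSpace g, f c Z ∈ Set.range (AlgPoints.map (L := ℂ) (ι c)) := fun c Z hZ => by
    rw [hrange c, hfibre c]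
    exact Set.mem_image_of_mem _ hZ
  have hD' : ∀ c, Set.range (AlgPoints.map (L := ℂ) (ι c)) ⊆ f c '' siegelUpperHalfSpace g := fun c => by
    rw [hrange c, hfibre c]
  -- G5–G7
  refine ⟨S, ι, fun c => Function.invFun (AlgPoints.map (L := ℂ) (ι c)) ∘ f c, hcol, hirr, fun c => ⟨?_, ?_, ?_, ?_, ?_⟩,
    fun c u' r' hu' hu'c hr'1 _hr'u hr'mat Z hZ => ⟨?_, ?_⟩⟩
  -- (U2+) continuity
  · exact AlgPoints.continuousOn_invFun_comp (ι c) (hUe' c).1 (hD c)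
  -- (U2+) openness
  · exact AlgPoints.isOpenMap_restrict_invFun_comp (ι c) (hUe' c).2.1 (hD c)
  -- (U2+) onto
  · exact AlgPoints.surjOn_invFun_comp (ι c) (hD c) (hD' c)
  -- (U2+) the `Γ_δ(N)`-relation
  · intro Z hZ Z' hZ'
    refine (AlgPoints.invFun_comp_apply_eq_iff (ι c) (hD c) hZ hZ').trans ?_
    refine Iff.trans ?_ (classifyingMap_eq_iff_rel hg hδ hN 𝓜 (hr1 c) hZ hZ' (hP₀ c Z hZ) (hP₀ c Z' hZ'))
    exact ⟨fun h => bCE.injective (((hf c Z hZ).symm.trans h).trans (hf c Z' hZ')),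
      fun h => ((hf c Z hZ).trans (congrArg bCE h)).trans (hf c Z' hZ').symm⟩
  -- (U2+) holomorphy in affine coordinates of the piece
  · exact AlgPoints.differentiableOn_evalOrZero_invFun_comp (ι c) (hD c) (hUe' c).2.2
  -- (U3∃): the triple of U-a at `(Z, r′)` is a pull-back of the universal one along `unif_c Z`
  · obtain ⟨P'', hP''⟩ := hUa g N δ hg hδ hN c u' r' hu' hu'c hr'1 _hr'u hr'mat Z hZ
    -- `unif_c Z ↦ f_c Z = bCE (classifyingMap P″)` on points
    have h12 : AlgPoints.map (ι c) ((Function.invFun (AlgPoints.map (L := ℂ) (ι c)) ∘ f c) Z) =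
        bCE (𝓜.classifyingMap (specOver ℚ ℂ) P'') :=
      (Function.invFun_eq (hD c Z hZ)).trans (hfP c u' r' hu' hu'c hr'1 hr'mat Z hZ P'' hP'')
    have hx : bCE.symm (AlgPoints.map (ι c) ((Function.invFun (AlgPoints.map (L := ℂ) (ι c)) ∘ f c) Z)) =
        𝓜.classifyingMap (specOver ℚ ℂ) P'' :=
      (congrArg bCE.symm h12).trans (bCE.symm_apply_apply _)
    obtain ⟨G, Ĝ, hBC⟩ := 𝓜.exists_isBaseChangeVia_classifyingMap (specOver ℚ ℂ) P''
    refine ⟨P'', G, Ĝ, ?_, hP''⟩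
    rw [hx]
    exact hBC
  -- (U3-D3): every admissible triple is classified by `unif_c Z`
  · intro P' hP'
    exact (Function.invFun_eq (hD c Z hZ)).trans (hfP c u' r' hu' hu'c hr'1 hr'mat Z hZ P' hP')

end Summit.HodgeConjecture.CorCM.HypDel.UHead

end
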